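import Literature.Topology.PlaneTopology.PolygonUmlaufsatz
import Literature.Topology.PlaneTopology.JordanSweepParity
import HarnessLib

/-!
# Orientation of a simple closed polygon at its lowest vertex; polygons as Jordan loops

Topic: Topology / PlaneTopology, sequel to `PolygonUmlaufsatz.lean` (Hopf's Umlaufsatz for simple
closed polygons, `IsSimplePolygon.sum_extAngle_eq`: the exterior angles sum to `2π` or `-2π`) and
`JordanSweepParity.lean` (`IsJordanLoop`, `inside`, `outside`). Two additions used by the contact
graphs of disc packings (`Literature.Geometry.DiscreteGeometry`, Harborth's theorem):

* **the sign in the Umlaufsatz** (`IsSimplePolygon.sum_extAngle_eq_two_pi_of_lowest`): if `z 0`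
  is a lowest vertex and the outgoing edge `z 1 - z 0` points to the right of the incoming edge
  reversed, `arg (z 1 - z 0) < arg (z (n-1) - z 0)` (both arguments lie in `[0, π]`), then the
  exterior angles sum to `+2π` — the polygon is run counter-clockwise. This is read off Hopf's
  own computation (H. Hopf, Compositio Math. 2 (1935), §2: the increments along the two legs of
  the secant chain are principal logarithms because the secants from the lowest vertex point into
  the upper half-plane), which pins the exterior angle at `z 0` to `arg (z 1 - z 0) -
  arg (z (n-1) - z 0) + π` rather than that value `- 2π`;
* **a simple closed polygon is a Jordan loop** (`IsSimplePolygon.isJordanLoop`): the rescaled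
  map `polygonLoop z n t = polygonMap z (n t)` is continuous, `1`-periodic and injective on
  `[0, 1)`; its range is the union of the closed edges (`range_polygonLoop`).

Everything here is proved. [cite: Hopf1935, Satz I]
-/

noncomputable section

open Complex Set Filter
open scoped Real

namespace Literature.Topology.PlaneTopology

variable {z : ℤ → ℂ} {n : ℕ}

/-! ### The argument of a vector in the closed upper half-plane, turned by a right angle -/

/-- For `w ≠ 0` in the closed upper half-plane, `arg (-I w) = arg w - π/2`. [folklore] -/
private theorem arg_negI_mul {w : ℂ} (hw : w ≠ 0) (him : 0 ≤ w.im) :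
    arg (-I * w) = arg w - π / 2 := by
  have h0 : 0 ≤ arg w := arg_nonneg_iff.2 him
  have hπ : arg w ≤ π := arg_le_pi w
  have hc : ((arg (-I * w) : ℝ) : Real.Angle) = ((arg w - π / 2 : ℝ) : Real.Angle) := by
    rw [arg_mul_coe_angle (neg_ne_zero.2 I_ne_zero) hw, arg_neg_I, Real.Angle.coe_sub,
      Real.Angle.coe_neg]
    abel
  obtain ⟨k, hk⟩ := Real.Angle.angle_eq_iff_two_pi_dvd_sub.1 hc
  have h1 := neg_pi_lt_arg (-I * w)
  have h2 := arg_le_pi (-I * w)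
  have hπ0 := Real.pi_pos
  have hk0 : k = 0 := by
    have : (k : ℝ) < 1 := by
      by_contra hcon; push Not at hcon; nlinarith
    have : (-1 : ℝ) < k := by
      by_contra hcon; push Not at hcon; nlinarith
    have h3 : k < 1 := by exact_mod_cast ‹(k : ℝ) < 1›
    have h4 : -1 < k := by exact_mod_cast ‹(-1 : ℝ) < k›
    omega
  rw [hk0] at hk; simp only [Int.cast_zero, mul_zero, sub_eq_zero] at hk; linarith

/-! ### The sign of the turning number at a lowest vertex -/

/-- **Hopf's Umlaufsatz with its sign, at a lowest vertex.** Let `z 0` be a lowest vertex of the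
simple closed polygon `z 0, …, z (n-1)`; both edge vectors `z 1 - z 0` and `z (n-1) - z 0` then
point into the closed upper half-plane. If `arg (z 1 - z 0) < arg (z (n-1) - z 0)` (the polygon
leaves `z 0` to the right of where it arrives), the exterior angles sum to `+2π`.
[cite: Hopf1935, Satz I] -/
theorem IsSimplePolygon.sum_extAngle_eq_two_pi_of_lowest (h : IsSimplePolygon z n)
    (hlow : ∀ i, (z 0).im ≤ (z i).im) (hlt : arg (z 1 - z 0) < arg (z (n - 1) - z 0)) :
    ∑ i ∈ Finset.range n, extAngle z i = 2 * π := by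
  -- Hopf's chain identity, as in `sum_extAngle_eq_of_lowest`
  obtain ⟨L, hL, hLe⟩ := h.hasLogOn_secantMap
  obtain ⟨mA, mB, mC, mD⟩ := h.mapsTo_hopf
  have eA := logInc_comp_of_log hL hLe (γ := hopfA n) (by unfold hopfA; fun_prop) mA
  have eB := logInc_comp_of_log hL hLe (γ := hopfB n) (by unfold hopfB; fun_prop) mB
  have eC := logInc_comp_of_log hL hLe (γ := hopfC n) (by unfold hopfC; fun_prop) mC
  have eD := logInc_comp_of_log hL hLe (γ := hopfD n) (by unfold hopfD; fun_prop) mD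
  have chain : logInc (secantMap z ∘ hopfA n) + logInc (secantMap z ∘ hopfB n) +
      logInc (secantMap z ∘ hopfC n) + logInc (secantMap z ∘ hopfD n) = 0 := by
    rw [eA, eB, eC, eD]
    have e1 : hopfA n 1 = hopfB n 0 := by rw [hopfA, hopfB, Prod.mk.injEq]; exact ⟨by ring, by ring⟩
    have e2 : hopfB n 1 = hopfC n 0 := by rw [hopfB, hopfC, Prod.mk.injEq]; exact ⟨by ring, by ring⟩
    have e3 : hopfC n 1 = hopfD n 0 := by rw [hopfC, hopfD, Prod.mk.injEq]; exact ⟨by ring, by ring⟩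
    have e4 : hopfD n 1 = hopfA n 0 := by rw [hopfD, hopfA, Prod.mk.injEq]; exact ⟨by ring, by ring⟩
    rw [e1, e2, e3, e4]; ring
  rw [logInc_hopfA h hlow, logInc_hopfB h, logInc_hopfC h hlow, logInc_hopfD h] at chain
  set a := z 0 - z (n - 1) with ha
  set b := z 1 - z 0 with hb
  have ha0 : a ≠ 0 := by
    rw [ha, ← h.vertex_neg_one, sub_ne_zero]
    have := h.ne_succ (-1); rwa [show (-1 : ℤ) + 1 = 0 by ring] at this
  have hb0 : b ≠ 0 := sub_ne_zero.2 (by have := h.ne_succ 0; rwa [zero_add] at this)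
  have him := congrArg Complex.im chain
  simp only [add_im, sub_im, neg_im, log_im, zero_im, Complex.im_sum] at him
  have hsum : ∑ i ∈ Finset.range n, extAngle z i =
      arg (b / a) + ∑ j ∈ Finset.range (n - 1), arg ((z (j + 2) - z (j + 1)) / (z (j + 1) - z j)) := by
    have hsplit : ∑ i ∈ Finset.range n, extAngle z i =
        ∑ j ∈ Finset.range (n - 1), extAngle z ((j + 1 : ℕ) : ℤ) + extAngle z ((0 : ℕ) : ℤ) := by
      conv_lhs => rw [show n = n - 1 + 1 from (Nat.sub_add_cancel h.pos).symm]
      exact Finset.sum_range_succ' (fun i : ℕ => extAngle z i) (n - 1)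
    rw [hsplit, add_comm]
    congr 1
    · rw [Nat.cast_zero, extAngle, zero_add, zero_sub, h.vertex_neg_one]
    · exact Finset.sum_congr rfl fun j _ => extAngle_natCast_succ z j
  set θ₀ := arg (b / a) with hθ
  set A := arg (-I * b) with hA
  set B := arg (I * a) with hB
  have hT : ∑ i ∈ Finset.range n, extAngle z i = 2 * (θ₀ + B - A) := by rw [hsum]; linarith
  -- the two right angles, explicitly: `A = arg b - π/2`, `B = arg (-a) - π/2`
  have hbim : 0 ≤ b.im := by rw [hb, sub_im]; linarith [hlow 1]
  have haim : 0 ≤ (-a).im := by rw [ha, neg_sub, sub_im]; linarith [hlow (n - 1)]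
  have hA' : A = arg b - π / 2 := arg_negI_mul hb0 hbim
  have hB' : B = arg (-a) - π / 2 := by
    rw [hB, show I * a = -I * -a by ring]
    exact arg_negI_mul (neg_ne_zero.2 ha0) haim
  have hlt' : arg b < arg (-a) := by rw [hb, ha, neg_sub]; exact hlt
  -- the congruence `θ₀ ≡ A - B + π (mod 2π)`
  have hcong : ((θ₀ : ℝ) : Real.Angle) = ((A - B + π : ℝ) : Real.Angle) := by
    have h1 : ((arg (b / a) : ℝ) : Real.Angle) = arg b - arg a := arg_div_coe_angle hb0 ha0
    have h2 : ((arg (-I * b) : ℝ) : Real.Angle) = arg (-I) + arg b :=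
      arg_mul_coe_angle (neg_ne_zero.2 I_ne_zero) hb0
    have h3 : ((arg (I * a) : ℝ) : Real.Angle) = arg I + arg a := arg_mul_coe_angle I_ne_zero ha0
    have h2' : ((arg b : ℝ) : Real.Angle) = arg (-I * b) - arg (-I) := by rw [h2]; abel
    have h3' : ((arg a : ℝ) : Real.Angle) = arg (I * a) - arg I := by rw [h3]; abel
    have hpi : ((π : ℝ) : Real.Angle) = ((π / 2 : ℝ) : Real.Angle) - (((-(π / 2)) : ℝ) : Real.Angle) := by
      rw [← Real.Angle.coe_sub]; congr 1; ring
    rw [hθ, hA, hB, h1, h2', h3', arg_neg_I, arg_I, Real.Angle.coe_add, Real.Angle.coe_sub, hpi]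
    abel
  obtain ⟨k, hk⟩ := Real.Angle.angle_eq_iff_two_pi_dvd_sub.1 hcong
  have hπ := Real.pi_pos
  have hθ1 : -π < θ₀ := neg_pi_lt_arg _
  have hθ2 : θ₀ ≤ π := arg_le_pi _
  have hb1 : -π < arg b := neg_pi_lt_arg _
  have ha1 : arg (-a) ≤ π := arg_le_pi _
  -- the sign: `k = 0`
  have hk0 : k = 0 := by
    rw [hA', hB'] at hk
    have hk1 : (k : ℝ) < 1 := by
      by_contra hcon; push Not at hcon; nlinarith
    have hk2 : (-1 : ℝ) < k := by
      by_contra hcon; push Not at hcon; nlinarith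
    have hk1' : k < 1 := by exact_mod_cast hk1
    have hk2' : -1 < k := by exact_mod_cast hk2
    omega
  rw [hk0] at hk
  rw [hT]
  push_cast at hk
  linarith

/-! ### A simple closed polygon is a Jordan loop -/

/-- The closed polygon `z 0, …, z (n-1)` run once over the parameter interval `[0, 1]`:
`polygonLoop z n t = polygonMap z (n t)`. [cite: Hopf1935, §1] -/
def polygonLoop (z : ℤ → ℂ) (n : ℕ) (t : ℝ) : ℂ := polygonMap z (n * t)

/-- The polygon map of an `n`-periodic vertex sequence is `n`-periodic. [cite: Hopf1935, §1] -/
theorem polygonMap_add_natCast (hper : Function.Periodic z n) (t : ℝ) :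
    polygonMap z (t + n) = polygonMap z t := by
  have hfl : ⌊t + n⌋ = ⌊t⌋ + n := by exact_mod_cast Int.floor_add_natCast t n
  rw [polygonMap, polygonMap, hfl]
  have e1 : z (⌊t⌋ + n) = z ⌊t⌋ := hper _
  have e2 : z (⌊t⌋ + n + 1) = z (⌊t⌋ + 1) := by rw [add_right_comm]; exact hper _
  rw [e1, e2]
  push_cast
  ring_nf

/-- The range of the polygon map is the union of the closed edges. [cite: Hopf1935, §1] -/
theorem range_polygonMap (z : ℤ → ℂ) : range (polygonMap z) = ⋃ i : ℤ, segment ℝ (z i) (z (i + 1)) := by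
  ext x
  simp only [mem_range, mem_iUnion]
  constructor
  · rintro ⟨t, rfl⟩; exact ⟨⌊t⌋, polygonMap_mem_segment z t⟩
  · rintro ⟨i, hx⟩
    rw [segment_eq_image'] at hx
    obtain ⟨θ, ⟨h0, h1⟩, rfl⟩ := hx
    refine ⟨i + θ, ?_⟩
    rw [polygonMap_of_mem_Icc z (k := i) ⟨by linarith, by linarith⟩]
    simp [Complex.real_smul]

/-- The range of the rescaled loop is the union of the closed edges (`n ≥ 1`). [cite: Hopf1935, §1] -/
theorem range_polygonLoop (z : ℤ → ℂ) (hn : 0 < n) :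
    range (polygonLoop z n) = ⋃ i : ℤ, segment ℝ (z i) (z (i + 1)) := by
  rw [← range_polygonMap]
  ext x
  simp only [mem_range, polygonLoop]
  constructor
  · rintro ⟨t, rfl⟩; exact ⟨_, rfl⟩
  · rintro ⟨s, rfl⟩
    refine ⟨s / n, ?_⟩
    have : (n : ℝ) ≠ 0 := by exact_mod_cast hn.ne'
    rw [mul_div_cancel₀ _ this]

/-- **A simple closed polygon is a Jordan loop**: the rescaled polygon map is continuous,
`1`-periodic and injective on `[0, 1)` (injectivity modulo the period, Hopf's "einfach
geschlossen"). [cite: Hopf1935, Satz I] -/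
theorem IsSimplePolygon.isJordanLoop (h : IsSimplePolygon z n) : IsJordanLoop (polygonLoop z n) where
  continuous := (continuous_polygonMap z).comp (continuous_const.mul continuous_id)
  periodic t := by
    simp only [polygonLoop]
    rw [mul_add, mul_one]
    exact polygonMap_add_natCast h.periodic _
  injOn s hs t ht hst := by
    simp only [polygonLoop] at hst
    obtain ⟨m, hm⟩ := h.exists_eq_add_of_eq hst
    have hn : (0 : ℝ) < n := by exact_mod_cast h.pos
    have h1 : (t - s : ℝ) = m := by
      have : (n : ℝ) * (t - s) = n * m := by linarith
      exact mul_left_cancel₀ hn.ne' this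
    have hlt : |(t - s : ℝ)| < 1 := by
      rw [abs_lt]; constructor <;> linarith [hs.1, hs.2, ht.1, ht.2]
    rw [h1] at hlt
    have hm0 : m = 0 := by
      have : |(m : ℝ)| < 1 := hlt
      rw [← Int.cast_abs] at this
      have : |m| < 1 := by exact_mod_cast this
      exact Int.abs_lt_one_iff.1 this
    rw [hm0] at h1; simp at h1; linarith

end Literature.Topology.PlaneTopology

end
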